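import Summits.QuantumFields.BalabanUV.T4Continuum.Support.NE7ConvOneStepWeighted
import Summits.QuantumFields.BalabanUV.T4Continuum.Support.NE7EtaMinimiserGaugeCovariance
import HarnessLib

/-!
# NE7RepOfRelRep — THE GAUGE ∕ SUP HALF OF THE REPRESENTATION LETTER IS ROW NE3's `RelRep` SHAPE: from `NE3HessShapes.RelRep U♯ U′ P α`
# ([Balaban1985Variational] Prop. 2 (19) TYPE: `u·U′ = U♯e^{X}` bondwise, `u` unitary periodic, `X` skew periodic, `‖X‖_∞ ≤ α`) and `U′` in the
# class, the first SIX conjuncts of CONV-ONE-STEP's REP package follow by the tree's gauge invariance of the level action and of the plaquette radius;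
# what REP asks BEYOND `RelRep` is exactly the slice split `X = X_T + X_N` with the two normal sizes (route Π TYPE)

Cell `pub-balaban`, rung (B)+1 sub-cell t4, lineage `b2b-balaban-t4-ne7-p1`, generation 66 (CRUX PROVER NE7 #1); hunt (h10), memo
`t4/b2b-balaban-t4-ne7-p1-g66/HUNT-H10-TWO-ROADS.md` §2 (b).  File F14 (junction of F4∕F9's REP package with row NE3's typed shape).

WHAT ([folklore]; 0 def, 0 sorry).
§1 **`rep_head_of_relRep`** — `RelRep Us U' P α` (row NE3's structure: fields `u`, `X`, `unitary_u`, `periodic_u`, `skew`, `periodic_X`, `rep`, `small`)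
   with `SmallField U' a` ⟹ for `X := R.X`: `IsSkewDir X`, `IsPeriodicDir X P`, `∀ b, ‖X b‖ ≤ α`, `levelAction d L N k (vary Us X 1) = levelAction d L N k U'`
   (`NE7EtaMinimiserGaugeCovariance.levelAction_gaugeAct`: the Wilson action is gauge invariant), `SmallField (vary Us X 1) a`
   (`BlockAverageCurrent.smallField_gaugeAct`: plaquette radii are gauge invariant).
§2 **`isMinimiser_of_critical_relRep_weighted`** — F9's `isMinimiser_of_critical_rep_weighted` with the representation hypothesis stated as: for every
   admissible `U′`, a `RelRep Us U' (N·L^k) α` (`0 ≤ α`) TOGETHER WITH a slice split of ITS direction `X = X_T + X_N` (`X_T ∈ T`, `X_N` skew, `0 ≤ ν`,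
   `‖X_N‖_w ≤ ν‖X‖_w`, `a·Σ‖d_{Us}X_N‖ ≤ κ₁‖X‖_w²`) and the k-free line.  So REP = `RelRep` (Prop. 2 (19) TYPE, row NE3's Π-R letter) + the split with
   route-Π-type sizes (Π-C ∕ Π-L1♮ TYPE) — both rows' typed shapes, by name.
HONEST FRAMING (page 1): bookkeeping over HYPOTHESES; `RelRep` is asserted for no pair; nothing of REP or CRIT proved; NOT ONE-STEP, NOT NE7; spine 0∕9;
finite T⁴ rung (B)+1 — NOT infinite volume, NOT mass gap, NOT Clay.  Continuum YM on T⁴ ⇐ BetaPertH ∧ nine spine estimates (0/9 proved); BetaPertH ⇐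
(D1) ∧ (D4) ∧ CAP+tail; G-an2-4 gates asym, D1 and NE2/3/4.
-/

set_option autoImplicit false

open scoped BigOperators Matrix.Norms.L2Operator
open NormedSpace Finset Set

namespace Summit.QuantumFields.BalabanUV.T4Continuum.NE7RepOfRelRep

open Literature.MathematicalPhysics.QuantumFieldTheory.Balaban1983to89
open B7Prop1Explicit B7Prop2Explicit MatrixLog UnitaryModel
open T4AveragingDeficitWall (IsUnitaryCfg IsSkewDir SmallField fineAction vary curl curlSq dirSq)
open T4AveragingDeficitWallBoundary (IsPeriodicCfg periodBox)
open AveragingDeficitPeriodicCounting (IsPeriodicDir)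
open MinimalActionLevels (levelAction perWin)
open MinimalActionSandwich (IsMinimiser admissible)
open NE3HessForm (dAction)
open NE3HessShapes (RelRep)
open NE3SlicePoincareShape (SlicePoincare)
open NE3EnergyWeightedShapes (energyNormW)
open BlockAverageCurrent (smallField_gaugeAct)
open NE7EtaMinimiserGaugeCovariance (levelAction_gaugeAct)
open NE7ConvOneStepWeighted (isMinimiser_of_critical_rep_weighted)

noncomputable section

variable {d : ℕ} {n : Type*} [Fintype n] [DecidableEq n]

/-! ## §1 The head of the REP package from `RelRep` -/

/-- **THE GAUGE ∕ SUP HALF OF REP FROM ROW NE3's `RelRep`.**  For `R : RelRep Us U' P α` and `SmallField U' a`: `R.X` is skew, `P`-periodic, `‖R.X b‖ ≤ α`,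
`levelAction (Us·e^{R.X}) = levelAction U'` and `SmallField (Us·e^{R.X}) a`. [folklore] -/
theorem rep_head_of_relRep [Nonempty n] {L N k : ℕ} {Us U' : Site d → Fin d → (Matrix n n ℂ)ˣ} {P : ℤ} {α a : ℝ} (R : RelRep Us U' P α)
    (hU'a : SmallField U' a) :
    IsSkewDir R.X ∧ IsPeriodicDir R.X P ∧ (∀ x μ, ‖R.X x μ‖ ≤ α) ∧
      levelAction d L N k (vary Us R.X 1) = levelAction d L N k U' ∧ SmallField (vary Us R.X 1) a := by
  refine ⟨R.skew, R.periodic_X, R.small, ?_, ?_⟩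
  · rw [← R.rep, levelAction_gaugeAct]
  · rw [← R.rep]; exact smallField_gaugeAct R.unitary_u hU'a

/-! ## §2 CONV-ONE-STEP with REP stated as `RelRep` + slice split with route-Π-type sizes -/

/-- **CONV-ONE-STEP FROM CRITICALITY ON A POINCARÉ SLICE AND, FOR EVERY COMPETITOR, A `RelRep` PLUS A SLICE SPLIT WITH WEIGHTED NORMAL SIZES** (F9 with §1;
`L, N ≥ 1`). [folklore] -/
theorem isMinimiser_of_critical_relRep_weighted [Nonempty n] {𝒞 : ℕ → Set (Site d → Fin d → (Matrix n n ℂ)ˣ)} {L N k : ℕ} (hL : 1 ≤ L)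
    (hN : 1 ≤ N) {V Us : Site d → Fin d → (Matrix n n ℂ)ˣ} (hmem : Us ∈ admissible 𝒞 L k V) (hUs : IsUnitaryCfg Us) {a : ℝ} (ha : 0 ≤ a)
    (hUsa : SmallField Us a) (hclass : ∀ U' ∈ admissible 𝒞 L k V, SmallField U' a) {T : Set (Site d → Fin d → Matrix n n ℂ)} {C : ℝ} (hC : 0 < C)
    (hP : SlicePoincare L k Us T C (periodBox (d := d) (N * L ^ k)))
    (hcrit : ∀ Y ∈ T, dAction Us Y (perWin d (N * L ^ k)) = 0)
    (hrel : ∀ U' ∈ admissible 𝒞 L k V, ∃ (α : ℝ) (R : RelRep Us U' ((N * L ^ k : ℕ) : ℤ) α) (XT XN : Site d → Fin d → Matrix n n ℂ) (ν κ₁ : ℝ),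
      0 ≤ α ∧ R.X = XT + XN ∧ XT ∈ T ∧ IsSkewDir XN ∧ 0 ≤ ν ∧
      energyNormW L k Us XN (periodBox (d := d) (N * L ^ k)) ≤ ν * energyNormW L k Us R.X (periodBox (d := d) (N * L ^ k)) ∧
      a * (∑ p ∈ perWin d (N * L ^ k), ‖curl Us XN p‖) ≤ κ₁ * energyNormW L k Us R.X (periodBox (d := d) (N * L ^ k)) ^ 2 ∧
      2 * κ₁ ≤ ((((1 / 2 - ν ^ 2) / (2 * (1 + C)) - ν ^ 2) / 2 - 576 * d * (Real.exp α - 1) ^ 2 * ((L : ℝ) ^ k) ^ 2) / (Fintype.card n : ℝ)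
          - 28 * d * (a + 7 * α ^ 2) * ((L : ℝ) ^ k) ^ 2)) :
    IsMinimiser d 𝒞 L N k V Us := by
  refine isMinimiser_of_critical_rep_weighted hL hN hmem hUs ha hUsa hC hP hcrit fun U' hU' => ?_
  obtain ⟨α, R, XT, XN, ν, κ₁, hα, hsplit, hXT, hXNs, hν, hNw, hN1, hline⟩ := hrel U' hU'
  obtain ⟨hXs, hXP, hXα, hle, h1⟩ := rep_head_of_relRep (L := L) (N := N) (k := k) R (hclass U' hU')
  exact ⟨R.X, XT, XN, α, ν, κ₁, hXs, hXP, hα, hXα, hle.le, h1, hsplit, hXT, hXNs, hν, hNw, hN1, hline⟩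

end

end Summit.QuantumFields.BalabanUV.T4Continuum.NE7RepOfRelRep
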